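import Mathlib

/-!
# A six-set antichain on nine points whose star does not isolate a member

Helper file for crux `stmt-CriticalPhenomena-4575` (`NoHeavyLowerTail`, route `PercNearOneGluingNoHeavy`),
new-inequality factory seat `prim-ineq-gen-3` (gen 26).  Everything here is PROVED; no definitions.

Pencil row of a set `C`: `E ↦ [E ⊆ C] + t [E ∩ C = ∅]`.  The order-free local strengthening of the pencil conjecture (C0) — 'a member `K` of an
antichain is isolated by the `2(m-1)+1` pencil columns THROUGH `K` (`∅`, `A \ K`, `K \ A`)' — was refuted in
`…OrderedDifferencesStarCounterexample` with ten sets on `23` points obtained from two graphs.  Allowing COMPARABLE traces (a preorder instead of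
a discrete order in the abstract two-structure form, memo `CONJECTURE-STAR.md` §6, §12) gives a much smaller failure, recorded here: the antichain
`K = 5678, A_1 = 01678, A_2 = 0258, A_3 = 1567, A_4 = 01235, A_5 = 012468` on nine points, `t² = t + 1`, and the functional
`c = (1 - t; -1, t - 1, -1, 1, 1)` (so `c K = 1 - t ≠ 0`), which kills `κ_∅` and the ten columns `A_l \ K`, `K \ A_l` over every field.
(Exact check: the full difference pencil of this family has rank `6` at these `t`, so (C0) and ORD hold for it; the other five members ARE
isolated by their stars; found by an exhaustive search over abstract (preorder, tolerance) pairs on five indices, memo `FINDINGS-gen26.md` F26-12.)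
* `starCex9_antichain`, `starCex9_sdiff` — antichain; the ten differences through `K`;
* `starCex9_sum_zero` — the functional kills the eleven star columns whenever `t² = t + 1`;  * `starCex9_head_ne_zero` — `1 - t ≠ 0`.
(prim-ineq-gen-3 gen 26, 2026-08-25.)
-/

namespace Summit.CriticalPhenomena.PercolationContinuityZ3.Theorems

namespace OrderedDifferences

open Finset

/-- The six sets `(5678, 01678, 0258, 1567, 01235, 012468)` (member `K = 5678` first) are pairwise incomparable. -/
theorem starCex9_antichain :
    ∀ i j : Fin 6, i ≠ j → ¬ (![{5, 6, 7, 8}, {0, 1, 6, 7, 8}, {0, 2, 5, 8}, {1, 5, 6, 7}, {0, 1, 2, 3, 5}, {0, 1, 2, 4, 6, 8}] : Fin 6 → Finset (Fin 9)) i ⊆ (![{5, 6, 7, 8}, {0, 1, 6, 7, 8}, {0, 2, 5, 8}, {1, 5, 6, 7}, {0, 1, 2, 3, 5}, {0, 1, 2, 4, 6, 8}] : Fin 6 → Finset (Fin 9)) j := by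
  decide

/-- The ten differences through `K = {5, 6, 7, 8}`: `A_l \\ K` and `K \\ A_l`, `l = 1, …, 5`. -/
theorem starCex9_sdiff :
    (({0, 1, 6, 7, 8} : Finset (Fin 9)) \ {5, 6, 7, 8} = {0, 1}) ∧
    (({0, 2, 5, 8} : Finset (Fin 9)) \ {5, 6, 7, 8} = {0, 2}) ∧
    (({1, 5, 6, 7} : Finset (Fin 9)) \ {5, 6, 7, 8} = {1}) ∧
    (({0, 1, 2, 3, 5} : Finset (Fin 9)) \ {5, 6, 7, 8} = {0, 1, 2, 3}) ∧
    (({0, 1, 2, 4, 6, 8} : Finset (Fin 9)) \ {5, 6, 7, 8} = {0, 1, 2, 4}) ∧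
    (({5, 6, 7, 8} : Finset (Fin 9)) \ {0, 1, 6, 7, 8} = {5}) ∧
    (({5, 6, 7, 8} : Finset (Fin 9)) \ {0, 2, 5, 8} = {6, 7}) ∧
    (({5, 6, 7, 8} : Finset (Fin 9)) \ {1, 5, 6, 7} = {8}) ∧
    (({5, 6, 7, 8} : Finset (Fin 9)) \ {0, 1, 2, 3, 5} = {6, 7, 8}) ∧
    (({5, 6, 7, 8} : Finset (Fin 9)) \ {0, 1, 2, 4, 6, 8} = {5, 7}) := by
  decide

/-- With `c = (1 - t; -1, t - 1, -1, 1, 1)` (`K` first) every pencil column `E` through `K` — `∅`, the five `A_l \\ K`, the five `K \\ A_l` —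
satisfies `∑_C c_C ([E ⊆ C] + t [E ∩ C = ∅]) = 0` whenever `t² = t + 1` (any field). -/
theorem starCex9_sum_zero {K : Type*} [Field K] (t : K) (ht : t ^ 2 = t + 1) :
    ∀ E ∈ ({∅, {0, 1}, {0, 2}, {1}, {0, 1, 2, 3}, {0, 1, 2, 4}, {5}, {6, 7}, {8}, {6, 7, 8}, {5, 7}} : Finset (Finset (Fin 9))),
      ∑ i : Fin 6, (![(1 - t : K), (-1 : K), (-1 + t : K), (-1 : K), (1 : K), (1 : K)] i) *
        ((if E ⊆ (![{5, 6, 7, 8}, {0, 1, 6, 7, 8}, {0, 2, 5, 8}, {1, 5, 6, 7}, {0, 1, 2, 3, 5}, {0, 1, 2, 4, 6, 8}] : Fin 6 → Finset (Fin 9)) i then (1 : K) else 0) + t * (if Disjoint E ((![{5, 6, 7, 8}, {0, 1, 6, 7, 8}, {0, 2, 5, 8}, {1, 5, 6, 7}, {0, 1, 2, 3, 5}, {0, 1, 2, 4, 6, 8}] : Fin 6 → Finset (Fin 9)) i) then (1 : K) else 0)) = 0 := by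
  intro E hE
  simp only [mem_insert, mem_singleton] at hE
  rcases hE with rfl | rfl | rfl | rfl | rfl | rfl | rfl | rfl | rfl | rfl | rfl
  · simp (config := { decide := true }) only [Fin.sum_univ_succ, Fin.sum_univ_zero, Matrix.cons_val_zero, Matrix.cons_val_succ, if_true]
    linear_combination (0 : K) * ht
  · simp (config := { decide := true }) only [Fin.sum_univ_succ, Fin.sum_univ_zero, Matrix.cons_val_zero, Matrix.cons_val_succ, if_true, if_false]
    linear_combination (-1 : K) * ht
  · simp (config := { decide := true }) only [Fin.sum_univ_succ, Fin.sum_univ_zero, Matrix.cons_val_zero, Matrix.cons_val_succ, if_true, if_false]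
    linear_combination (-1 : K) * ht
  · simp (config := { decide := true }) only [Fin.sum_univ_succ, Fin.sum_univ_zero, Matrix.cons_val_zero, Matrix.cons_val_succ, if_true, if_false]
    linear_combination (0 : K) * ht
  · simp (config := { decide := true }) only [Fin.sum_univ_succ, Fin.sum_univ_zero, Matrix.cons_val_zero, Matrix.cons_val_succ, if_true, if_false]
    linear_combination (-1 : K) * ht
  · simp (config := { decide := true }) only [Fin.sum_univ_succ, Fin.sum_univ_zero, Matrix.cons_val_zero, Matrix.cons_val_succ, if_true, if_false]
    linear_combination (-1 : K) * ht
  · simp (config := { decide := true }) only [Fin.sum_univ_succ, Fin.sum_univ_zero, Matrix.cons_val_zero, Matrix.cons_val_succ, if_true, if_false]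
    linear_combination (0 : K) * ht
  · simp (config := { decide := true }) only [Fin.sum_univ_succ, Fin.sum_univ_zero, Matrix.cons_val_zero, Matrix.cons_val_succ, if_true, if_false]
    linear_combination (1 : K) * ht
  · simp (config := { decide := true }) only [Fin.sum_univ_succ, Fin.sum_univ_zero, Matrix.cons_val_zero, Matrix.cons_val_succ, if_true, if_false]
    linear_combination (0 : K) * ht
  · simp (config := { decide := true }) only [Fin.sum_univ_succ, Fin.sum_univ_zero, Matrix.cons_val_zero, Matrix.cons_val_succ, if_true, if_false]
    linear_combination (0 : K) * ht
  · simp (config := { decide := true }) only [Fin.sum_univ_succ, Fin.sum_univ_zero, Matrix.cons_val_zero, Matrix.cons_val_succ, if_true, if_false]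
    linear_combination (0 : K) * ht

/-- The `K`-coordinate `1 - t` of the functional is non-zero whenever `t² = t + 1`; hence the indicator of `K` is NOT in the span of the eleven
columns through `K` at such `t`. -/
theorem starCex9_head_ne_zero {K : Type*} [Field K] (t : K) (ht : t ^ 2 = t + 1) : (1 - t : K) ≠ 0 := by
  intro h
  have h1 : t = 1 := (sub_eq_zero.mp h).symm
  subst h1
  exact one_ne_zero (by linear_combination -ht : (1 : K) = 0)

end OrderedDifferences

end Summit.CriticalPhenomena.PercolationContinuityZ3.Theorems
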